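import Summits.ResolutionOfSingularities.ResolutionOfSingularities.Theorems.PurelyInseparableDim4PolyhedraCF
import HarnessLib

/-!
# [OURS · res-dim4-pi Q-CF∀, dimension ≤ 2] Cardinality-first WINS Hironaka's game in two active coordinates

Cell `res-dim4-pi` (D-0157 DOOR 2), the desk's open rule question **Q-CF∀** (WORD #28 (d) / #29 (b) / #31 (c):
«one CARDINALITY-FIRST positional strategy wins Hironaka's polyhedra game from every position»; rule question of
`res-dim4-p-7` / `res-dim4-p-8` / `res-dim4-p-10`).  Continues `PurelyInseparableDim4PolyhedraCF` (seat
`res-dim4-p-10`, «width 10»), which reduced Q-CF∀ for the strict game to the hypothesis-shape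
`PolyhedraGame.WeakWinCF σ I` (cardinality-first forces the WEAK win) in every set of active coordinates.

Here that hypothesis is PROVED for `#I ≤ 2`, with an explicit strictly decreasing potential, so that Q-CF∀ holds
outright in dimension ≤ 2 and, in the cell's dimension 4, only the sets of 3 and 4 active coordinates remain:

* §1 tools: `exists_isCF_of_permissible` (a least permissible centre exists), `forcesCF_weak_of_measure`
  (a potential that every cardinality-first move lowers, unless it wins, gives `ForcesCF (WeakWon …)`);
* §2 the potential of two coordinates `i₁, i₂`: `colMin k P` (least `a k`), `argCol`, `rowMin i k P` (least
  `a i` among the points minimising `a k`) and **`pot i₁ i₂ P = rowMin i₁ i₂ P + rowMin i₂ i₁ P`** («x of the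
  left-most point of the bottom row + y of the lowest point of the left column»); the core estimate
  `pot_move_lt`: a divisor move `{i₁}`, or the pair move `{i₁, i₂}` read in the chart `i₁` when the column
  minimum `ω_{i₂} < t` (which is exactly when cardinality-first plays the pair), lowers `pot` strictly — the
  bottom row keeps its points and moves left by `t − ω_{i₂} ≥ 1` (resp. by `t`), while the new left column
  consists of the images of the least-degree points, whose `i₂`-coordinates do not exceed the old one;
* §3 **`weakWinCF_of_card_le_two : I.card ≤ 2 → WeakWinCF σ I`** and
  **`forcesCF_strict_of_card_le_two : I.card ≤ 2 → 0 < t → ForcesCF (StrictWon t I) t I P`** (with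
  `forcesCF_strict_of_weakWinCF`): in at most two active coordinates EVERY cardinality-first play is finite,
  whatever B answers (A never has a real choice there), and reaches the strict win.

[OURS · counted 0 · elementary · AI work weaker than expert review] A combinatorial game; nothing is claimed in
dimension 3 or 4 (Q-CF∀ there stays OPEN); NOTHING here proves resolution of singularities in dimension ≥ 4 /
characteristic `p`.
bears_on: LADDER-RESOLUTION:D157-DOOR2 (res-dim4-pi · Q-CF∀). Supports stmt-ResolutionOfSingularities-16155
(helper).
-/

set_option linter.dupNamespace false -- mandated namespace of this single-conjunct summit

noncomputable section

namespace Summit.ResolutionOfSingularities.ResolutionOfSingularities.Theorems.PIDim4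

namespace PolyhedraGame

open Finset
open Literature.AlgebraicGeometry.Resolution
open Literature.AlgebraicGeometry.Resolution.CentreBlowup

variable {σ : Type} [DecidableEq σ]

/-! ## §1 Tools -/

omit [DecidableEq σ] in
/-- If some `J ⊆ I` is permissible, a cardinality-first centre exists. [folklore] -/
theorem exists_isCF_of_permissible {t : ℕ} {I : Finset σ} {P : Pos σ}
    (h : ∃ J : Finset σ, J ⊆ I ∧ Permissible t J P) : ∃ J, IsCF t I J P := by
  classical
  have hex : ∃ n, ∃ J : Finset σ, J ⊆ I ∧ Permissible t J P ∧ J.card = n :=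
    let ⟨J, hJI, hJ⟩ := h; ⟨J.card, J, hJI, hJ, rfl⟩
  obtain ⟨J, hJI, hJ, hcard⟩ := Nat.find_spec hex
  refine ⟨J, hJI, hJ, fun J' hJ'I hJ' => ?_⟩
  rw [hcard]
  exact Nat.find_min' hex ⟨J', hJ'I, hJ', rfl⟩

omit [DecidableEq σ] in
/-- At a position not weakly won, `I` itself is permissible (`I ≠ ∅`), so a cardinality-first centre exists.
[folklore] -/
theorem exists_isCF_of_not_weakWon {t : ℕ} {I : Finset σ} (hI : I.Nonempty) {P : Pos σ}
    (hP : ¬ WeakWon t I P) : ∃ J, IsCF t I J P := by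
  refine exists_isCF_of_permissible ⟨I, subset_rfl, hI, fun a ha => ?_⟩
  by_contra hlt
  exact hP (Or.inr ⟨a, ha, by omega⟩)

omit [DecidableEq σ] in
/-- A not weakly won position is non-empty. [folklore] -/
theorem nonempty_of_not_weakWon {t : ℕ} {I : Finset σ} {P : Pos σ} (hP : ¬ WeakWon t I P) : P.Nonempty := by
  rw [Finset.nonempty_iff_ne_empty]
  exact fun h => hP (Or.inl h)

/-- **Potential method.** If at every position that is not weakly won SOME cardinality-first centre leads, for
every answer of B, to a weakly won position or to a smaller value of `μ`, then cardinality-first forces the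
weak win from every position. [folklore] -/
theorem forcesCF_weak_of_measure {t : ℕ} {I : Finset σ} (μ : Pos σ → ℕ)
    (h : ∀ P : Pos σ, ¬ WeakWon t I P → ∃ J, IsCF t I J P ∧
      ∀ j ∈ J, WeakWon t I (move t J j P) ∨ μ (move t J j P) < μ P) :
    ∀ P : Pos σ, ForcesCF (WeakWon t I) t I P := by
  suffices main : ∀ (n : ℕ) (P : Pos σ), μ P = n → ForcesCF (WeakWon t I) t I P from
    fun P => main _ P rfl
  intro n
  induction n using Nat.strong_induction_on with
  | _ n IH =>
    intro P hn
    rcases Classical.em (WeakWon t I P) with hW | hW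
    · exact ForcesCF.won hW
    · obtain ⟨J, hJ, hch⟩ := h P hW
      refine ForcesCF.step J hJ fun j hj => ?_
      rcases hch j hj with hw | hlt
      · exact ForcesCF.won hw
      · exact IH _ (hn ▸ hlt) _ rfl

/-! ## §2 The potential of two coordinates -/

/-- The least value of the coordinate `k` on the position (`0` on the empty position). [folklore] -/
def colMin (k : σ) (P : Pos σ) : ℕ :=
  if h : P.Nonempty then (P.image fun a => a k).min' (h.image _) else 0

/-- The points minimising the coordinate `k`. [folklore] -/
def argCol (k : σ) (P : Pos σ) : Pos σ := P.filter fun a => a k = colMin k P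

/-- The least value of `a i` among the points minimising `a k`. [folklore] -/
def rowMin (i k : σ) (P : Pos σ) : ℕ := colMin i (argCol k P)

/-- **The potential of the pair `(i₁, i₂)`**: «`x` of the left-most point of the bottom row» plus «`y` of the
lowest point of the left column». [folklore] -/
def pot (i₁ i₂ : σ) (P : Pos σ) : ℕ := rowMin i₁ i₂ P + rowMin i₂ i₁ P

omit [DecidableEq σ] in
/-- `colMin` is a lower bound. [folklore] -/
theorem colMin_le (k : σ) {P : Pos σ} {a : σ →₀ ℕ} (ha : a ∈ P) : colMin k P ≤ a k := by
  unfold colMin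
  rw [dif_pos ⟨a, ha⟩]
  exact Finset.min'_le _ _ (Finset.mem_image_of_mem _ ha)

omit [DecidableEq σ] in
/-- `colMin` is attained. [folklore] -/
theorem exists_eq_colMin (k : σ) {P : Pos σ} (h : P.Nonempty) : ∃ a ∈ P, a k = colMin k P := by
  unfold colMin
  rw [dif_pos h]
  obtain ⟨a, ha, hak⟩ := Finset.mem_image.mp (Finset.min'_mem (P.image fun a => a k) (h.image _))
  exact ⟨a, ha, hak⟩

omit [DecidableEq σ] in
/-- A point minimising `a k` pointwise lies in `argCol k`. [folklore] -/
theorem mem_argCol_of_forall_le (k : σ) {P : Pos σ} {a : σ →₀ ℕ} (ha : a ∈ P)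
    (hmin : ∀ b ∈ P, a k ≤ b k) : a ∈ argCol k P := by
  refine Finset.mem_filter.mpr ⟨ha, le_antisymm ?_ (colMin_le k ha)⟩
  obtain ⟨b, hb, hbk⟩ := exists_eq_colMin k (P := P) ⟨a, ha⟩
  rw [← hbk]
  exact hmin b hb

omit [DecidableEq σ] in
/-- (R1) `rowMin i k` is at most `a i` for every point `a` minimising the coordinate `k`. [folklore] -/
theorem rowMin_le (i k : σ) {P : Pos σ} {a : σ →₀ ℕ} (ha : a ∈ P) (hmin : ∀ b ∈ P, a k ≤ b k) :
    rowMin i k P ≤ a i :=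
  colMin_le i (mem_argCol_of_forall_le k ha hmin)

omit [DecidableEq σ] in
/-- (R2) `rowMin i k` is attained at a point minimising the coordinate `k`. [folklore] -/
theorem exists_rowMin (i k : σ) {P : Pos σ} (h : P.Nonempty) :
    ∃ a ∈ P, (∀ b ∈ P, a k ≤ b k) ∧ a i = rowMin i k P := by
  obtain ⟨a₀, ha₀, ha₀k⟩ := exists_eq_colMin k h
  have hne : (argCol k P).Nonempty := ⟨a₀, Finset.mem_filter.mpr ⟨ha₀, ha₀k⟩⟩
  obtain ⟨a, ha, hai⟩ := exists_eq_colMin i hne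
  obtain ⟨haP, hak⟩ := Finset.mem_filter.mp ha
  exact ⟨a, haP, fun b hb => hak ▸ colMin_le k hb, hai⟩

/-- **Core estimate.** Let `i₁ ≠ i₂`, `t > 0`, and let `J = {i₁}` (divisor move) or `J = {i₁, i₂}` with the column
minimum `ω_{i₂} < t` (the situation in which cardinality-first plays the pair).  If `J` is permissible, the
move read in the chart `i₁` lowers the potential `pot i₁ i₂` strictly. [folklore] -/
theorem pot_move_lt {t : ℕ} (ht : 0 < t) {i₁ i₂ : σ} (hne : i₁ ≠ i₂) {P : Pos σ} (hP : P.Nonempty)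
    {J : Finset σ} (hJ : J = {i₁} ∨ (J = {i₁, i₂} ∧ colMin i₂ P < t)) (hperm : Permissible t J P) :
    pot i₁ i₂ (move t J i₁ P) < pot i₁ i₂ P := by
  -- the move changes the coordinate `i₁` only
  have hoff : ∀ a : σ →₀ ℕ, chartExponent t J i₁ a i₂ = a i₂ := fun a =>
    chartExponent_apply_of_ne t J hne.symm a
  have hon : ∀ a : σ →₀ ℕ, chartExponent t J i₁ a i₁ = degIn J a - t := fun a =>
    chartExponent_apply_self t J i₁ a
  -- `degIn J` in the two cases
  have hdeg : ∀ a : σ →₀ ℕ, (J = {i₁} → degIn J a = a i₁) ∧ (J = {i₁, i₂} → degIn J a = a i₁ + a i₂) :=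
    fun a => ⟨fun h => by rw [h, degIn_singleton], fun h => by rw [h, degIn_pair hne]⟩
  have hmem : ∀ {a : σ →₀ ℕ}, a ∈ P → chartExponent t J i₁ a ∈ move t J i₁ P := fun ha =>
    Finset.mem_image_of_mem _ ha
  have hmem' : ∀ {b' : σ →₀ ℕ}, b' ∈ move t J i₁ P → ∃ b ∈ P, chartExponent t J i₁ b = b' := fun hb' =>
    Finset.mem_image.mp hb'
  -- Part A: the bottom row (`a i₂` minimal) keeps its points and moves left strictly
  obtain ⟨s, hs, hsmin, hsx⟩ := exists_rowMin i₁ i₂ hP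
  have hA : rowMin i₁ i₂ (move t J i₁ P) < rowMin i₁ i₂ P := by
    have hle : rowMin i₁ i₂ (move t J i₁ P) ≤ chartExponent t J i₁ s i₁ := by
      refine rowMin_le i₁ i₂ (hmem hs) fun b' hb' => ?_
      obtain ⟨b, hb, rfl⟩ := hmem' hb'
      rw [hoff, hoff]
      exact hsmin b hb
    have hst : t ≤ degIn J s := hperm.2 s hs
    have hlt : chartExponent t J i₁ s i₁ < s i₁ := by
      rw [hon]
      rcases hJ with hJ1 | ⟨hJ2, hcol⟩
      · rw [(hdeg s).1 hJ1] at hst ⊢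
        omega
      · have hs2 : s i₂ < t := by
          obtain ⟨b, hb, hbk⟩ := exists_eq_colMin i₂ hP
          have := hsmin b hb
          omega
        rw [(hdeg s).2 hJ2] at hst ⊢
        omega
    omega
  -- Part B: the lowest point of the new left column has `i₂`-coordinate at most the old one
  obtain ⟨c, hc, hcmin, hcy⟩ := exists_rowMin i₂ i₁ hP
  have hB : rowMin i₂ i₁ (move t J i₁ P) ≤ rowMin i₂ i₁ P := by
    rcases hJ with hJ1 | ⟨hJ2, -⟩
    · -- divisor move: `c` stays left-most and keeps its `i₂`
      have hcle : rowMin i₂ i₁ (move t J i₁ P) ≤ chartExponent t J i₁ c i₂ := by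
        refine rowMin_le i₂ i₁ (hmem hc) fun b' hb' => ?_
        obtain ⟨b, hb, rfl⟩ := hmem' hb'
        rw [hon, hon, (hdeg c).1 hJ1, (hdeg b).1 hJ1]
        exact Nat.sub_le_sub_right (hcmin b hb) t
      rw [hoff, hcy] at hcle
      exact hcle
    · -- pair move: a point `d` of least `a i₁ + a i₂` becomes left-most, and `d i₂ ≤ c i₂`
      obtain ⟨d, hd, hdmin⟩ := Finset.exists_min_image P (fun a => degIn J a) hP
      have hdle : rowMin i₂ i₁ (move t J i₁ P) ≤ chartExponent t J i₁ d i₂ := by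
        refine rowMin_le i₂ i₁ (hmem hd) fun b' hb' => ?_
        obtain ⟨b, hb, rfl⟩ := hmem' hb'
        rw [hon, hon]
        exact Nat.sub_le_sub_right (hdmin b hb) t
      rw [hoff] at hdle
      have h1 := hdmin c hc
      have h2 := hcmin d hd
      rw [(hdeg d).2 hJ2, (hdeg c).2 hJ2] at h1
      omega
  unfold pot
  omega

omit [DecidableEq σ] in
/-- The potential is symmetric in the two coordinates. [folklore] -/
theorem pot_comm (i₁ i₂ : σ) (P : Pos σ) : pot i₁ i₂ P = pot i₂ i₁ P := Nat.add_comm _ _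

/-! ## §3 Dimension ≤ 2 -/

omit [DecidableEq σ] in
/-- No active coordinate: every position is weakly won. [folklore] -/
theorem weakWon_empty {t : ℕ} {P : Pos σ} : WeakWon t (∅ : Finset σ) P := by
  rcases P.eq_empty_or_nonempty with h | ⟨a, ha⟩
  · exact Or.inl h
  · exact Or.inr ⟨a, ha, by rw [degIn_empty]; exact Nat.zero_le _⟩

/-- Dimension 0. [folklore] -/
theorem weakWinCF_empty : WeakWinCF σ (∅ : Finset σ) := fun _ _ _ => ForcesCF.won weakWon_empty

/-- **Dimension 1**: the divisor move `{i}` is forced and lowers every `a i` by `t`. [folklore] -/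
theorem weakWinCF_singleton (i : σ) : WeakWinCF σ ({i} : Finset σ) := by
  intro t ht
  refine forcesCF_weak_of_measure (colMin i) fun P hP => ?_
  have hPne := nonempty_of_not_weakWon hP
  have hall : ∀ a ∈ P, t < a i := fun a ha => by
    by_contra hle
    push Not at hle
    exact hP (Or.inr ⟨a, ha, by rw [degIn_singleton]; exact hle⟩)
  have hperm : Permissible t ({i} : Finset σ) P :=
    ⟨Finset.singleton_nonempty i, fun a ha => by rw [degIn_singleton]; exact (hall a ha).le⟩
  refine ⟨{i}, ⟨subset_rfl, hperm, fun J' _ hJ' => ?_⟩, fun j hj => Or.inr ?_⟩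
  · rw [Finset.card_singleton]
    exact Finset.card_pos.mpr hJ'.1
  · rw [Finset.mem_singleton] at hj
    rw [hj]
    obtain ⟨s, hs, hsk⟩ := exists_eq_colMin i hPne
    have hle : colMin i (move t {i} i P) ≤ chartExponent t {i} i s i :=
      colMin_le i (Finset.mem_image_of_mem _ hs)
    rw [chartExponent_apply_self, degIn_singleton] at hle
    have := hall s hs
    omega

/-- **Dimension 2**: every cardinality-first move lowers `pot i₁ i₂` unless it wins. [folklore] -/
theorem weakWinCF_pair {i₁ i₂ : σ} (hne : i₁ ≠ i₂) : WeakWinCF σ ({i₁, i₂} : Finset σ) := by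
  intro t ht
  refine forcesCF_weak_of_measure (pot i₁ i₂) fun P hP => ?_
  have hPne := nonempty_of_not_weakWon hP
  obtain ⟨J, hJ⟩ := exists_isCF_of_not_weakWon (Finset.insert_nonempty i₁ {i₂}) hP
  refine ⟨J, hJ, fun j hj => Or.inr ?_⟩
  obtain ⟨hJI, hperm, hleast⟩ := hJ
  -- with the chart variable called `k₁` and the other one `k₂`: `J = {k₁}` or `J = {k₁, k₂}`
  have key : ∀ {k₁ k₂ : σ}, k₁ ≠ k₂ → ({k₁, k₂} : Finset σ) = {i₁, i₂} → k₁ ∈ J →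
      pot k₁ k₂ (move t J k₁ P) < pot k₁ k₂ P := by
    intro k₁ k₂ hk hpair hk₁
    have hJI' : J ⊆ ({k₁, k₂} : Finset σ) := by rw [hpair]; exact hJI
    rcases Classical.em (k₂ ∈ J) with hk₂ | hk₂
    · have hJeq : J = {k₁, k₂} := by
        refine Finset.Subset.antisymm hJI' fun x hx => ?_
        rcases Finset.mem_insert.mp hx with hx1 | hx2
        · rw [hx1]; exact hk₁
        · rw [Finset.mem_singleton] at hx2
          rw [hx2]; exact hk₂
      -- the pair is least only if the divisor `{k₂}` is not permissible: `ω_{k₂} < t`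
      have hcol : colMin k₂ P < t := by
        by_contra hge
        push Not at hge
        have hperm2 : Permissible t ({k₂} : Finset σ) P :=
          ⟨Finset.singleton_nonempty _, fun a ha => by
            rw [degIn_singleton]; exact hge.trans (colMin_le k₂ ha)⟩
        have hsub2 : ({k₂} : Finset σ) ⊆ {i₁, i₂} := by
          rw [← hpair]
          exact Finset.singleton_subset_iff.mpr (by simp)
        have hcard := hleast {k₂} hsub2 hperm2
        rw [hJeq, Finset.card_pair hk, Finset.card_singleton] at hcard
        omega
      exact pot_move_lt ht hk hPne (Or.inr ⟨hJeq, hcol⟩) hperm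
    · have hJeq : J = ({k₁} : Finset σ) := by
        refine Finset.Subset.antisymm (fun x hx => ?_) (Finset.singleton_subset_iff.mpr hk₁)
        rcases Finset.mem_insert.mp (hJI' hx) with hx1 | hx2
        · rw [hx1]; exact Finset.mem_singleton_self _
        · rw [Finset.mem_singleton] at hx2
          rw [hx2] at hx
          exact absurd hx hk₂
      exact pot_move_lt ht hk hPne (Or.inl hJeq) hperm
  have hj12 : j = i₁ ∨ j = i₂ := by
    have := hJI hj
    simpa only [Finset.mem_insert, Finset.mem_singleton] using this
  rcases hj12 with hj1 | hj2
  · rw [hj1] at hj ⊢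
    exact key hne rfl hj
  · rw [hj2] at hj ⊢
    rw [pot_comm, pot_comm i₁]
    exact key hne.symm (Finset.pair_comm _ _) hj

/-- **Cardinality-first wins the WEAK game in at most two active coordinates.** [folklore] -/
theorem weakWinCF_of_card_le_two {I : Finset σ} (hI : I.card ≤ 2) : WeakWinCF σ I := by
  rcases Nat.lt_or_ge I.card 1 with h0 | h1
  · have hI0 : I = ∅ := Finset.card_eq_zero.mp (by omega)
    rw [hI0]
    exact weakWinCF_empty
  · rcases Nat.lt_or_ge I.card 2 with h1' | h2
    · obtain ⟨i, hi⟩ := Finset.card_eq_one.mp (show I.card = 1 by omega)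
      rw [hi]
      exact weakWinCF_singleton i
    · obtain ⟨i₁, i₂, hne, hI2⟩ := Finset.card_eq_two.mp (show I.card = 2 by omega)
      rw [hI2]
      exact weakWinCF_pair hne

/-- **Q-CF∀ IN DIMENSION ≤ 2**: in at most two active coordinates cardinality-first forces the STRICT win from
every position, every threshold `t > 0` (the weak win above + the cardinality-first boundary lemma of
`PurelyInseparableDim4PolyhedraCF`). [folklore] -/
theorem forcesCF_strict_of_card_le_two {I : Finset σ} (hI : I.card ≤ 2) {t : ℕ} (ht : 0 < t) (P : Pos σ) :
    ForcesCF (StrictWon t I) t I P :=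
  forcesCF_strict_of_weakWinCF I
    (fun _ hI' => weakWinCF_of_card_le_two ((Finset.card_le_card hI').trans hI)) ht P

end PolyhedraGame

end Summit.ResolutionOfSingularities.ResolutionOfSingularities.Theorems.PIDim4

end
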